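import Summits.Langlands.Langlands.Theorems.QuarterDeficit1951IcosahedralSupplyOfPstBdR

/-!
# Route `QuarterDeficit1951` (Langlands) — crux `IcosahedralSupply` (stmt-Langlands-15899): CLOSING FILE

Line `Sketch` (leads c0, c1, c2).  Requires the D1 upgrade of `FontaineDpst` (p137078:
`fontainePstAdicCompletion_𝔅_eq_bdRPeriodRingData`).  The crux by name:
`IcosahedralSupply_of_pst_periodRing_eq_bdR` (file `…OfPstBdR`) with its one hypothesis — the period
ring of the pinned datum of `ℚ` at the place above `1951` IS `bdRPeriodRingData` — discharged by the
upgraded pin.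
-/

set_option linter.dupNamespace false

noncomputable section

open scoped NumberField
open Field IsDedekindDomain ValuativeRel
open Literature.NumberTheory.GaloisRepresentations Literature.NumberTheory.PAdicHodge

namespace Summit.Langlands.Langlands.Theorems.QuarterDeficit1951

/-- **The last stub of line `Sketch`**: at the place `v` of `ℚ` above `1951` the period ring of the
pinned datum `fontainePstAdicCompletion v 1951 hv` IS Fontaine's `B_dR(ℚ_v)` (`bdRPeriodRingData`) —
the accepted `fontainePstAdicCompletion_𝔅_eq_bdRPeriodRingData` (D1 upgrade of the pin).
[cite: FontaineAsterisque223III, Exp. II §1.5 and Exp. III §3] -/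
theorem stub_pst_periodRing_eq_bdR_1951 [Fact (Nat.Prime 1951)]
    (v : HeightOneSpectrum (𝓞 ℚ)) (hv : ((1951 : ℕ) : 𝓞 ℚ) ∈ v.asIdeal)
    [CharZero (v.adicCompletion ℚ)] [Fact (¬ IsUnit ((1951 : ℕ) : integerC (v.adicCompletion ℚ)))]
    [IsAdicComplete (Ideal.span {((1951 : ℕ) : integerC (v.adicCompletion ℚ))})
      (integerC (v.adicCompletion ℚ))] :
    (fontainePstAdicCompletion v 1951 hv).𝔅 =
      @bdRPeriodRingData (v.adicCompletion ℚ) _ _ _ _ _ 1951 _ _ _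
        (LocalField.valuation_adicCompletion_natCast_lt_one v 1951 hv)
        (fontainePstAdicCompletion v 1951 hv).algebra :=
  fontainePstAdicCompletion_𝔅_eq_bdRPeriodRingData v 1951 hv

/-- **The stub of continuation lead c1, now a theorem**: for the pinned datum of `ℚ` at the place `v`
above `1951`, every finite-image local representation `Γ_{ℚ_v} → GL_n(ℚ̄_1951)` is de Rham — the accepted
`fontainePstAdicCompletion_isDeRhamFramed_of_finite_range` (finite image ⇒ `B_dR`-de Rham for the
genuine ring, and the pinned datum's ring IS `B_dR`). [cite: FontaineAsterisque223III, Exp. III §1.5 and §3]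
[cite: FontaineMazurGeometric1995, §1] -/
theorem stub_finiteImage_isDeRhamFramed_1951 [Fact (Nat.Prime 1951)]
    (v : HeightOneSpectrum (𝓞 ℚ)) (hv : ((1951 : ℕ) : 𝓞 ℚ) ∈ v.asIdeal) {n : ℕ}
    (r : FramedGaloisRep (v.adicCompletion ℚ) (PadicAlgCl 1951) n) (hr : (Set.range r).Finite) :
    (fontainePstAdicCompletion v 1951 hv).IsDeRhamFramed r :=
  fontainePstAdicCompletion_isDeRhamFramed_of_finite_range v 1951 hv r hr

/-- **The crux `IcosahedralSupply` (item stmt-Langlands-15899), proved.**  For every reciprocity datum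
`RD` of `ℚ` and every prime `ℓ ≥ 17` there are `ι : ℚ̄_ℓ ≃ ℂ` and an irreducible, finite-image, even
`ρ : Γ_ℚ → GL₂(ℚ̄_ℓ)` of Artin conductor `1951`, geometric in the summit's sense, with an order-`5`
determinant character and icosahedral Frobenius fingerprint away from `1951`: the Doud–Moore even
icosahedral representation (`artinSupply`, `IcosahedralSupply_away` at `ℓ ≠ 1951`), whose local
component at `v = (1951)` — finite image — is de Rham for the pinned datum because that datum's period
ring IS Fontaine's `B_dR(ℚ_v)` (`stub_pst_periodRing_eq_bdR_1951`) and finite-image representations are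
`B_dR`-de Rham (Hilbert 90 over a finite Galois splitting field, `F̄ ↪ B_dR⁺`, Fontaine's inequality).
[cite: DoudMoore2006, §2 and §4] [cite: FontaineAsterisque223III, Exp. III §1.5 and §3] -/
theorem IcosahedralSupply_proof :
    Summit.Langlands.Langlands.Theses.QuarterDeficit1951.IcosahedralSupply :=
  IcosahedralSupply_of_pst_periodRing_eq_bdR fun v hv _ _ _ => stub_pst_periodRing_eq_bdR_1951 v hv

end Summit.Langlands.Langlands.Theorems.QuarterDeficit1951

end
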